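import Literature.NumberTheory.Automorphic.UnboundedDenominatorsDegreeStabilizerProofs
import Literature.NumberTheory.Automorphic.UnboundedDenominatorsDilationWitnessProofs
import Literature.NumberTheory.Automorphic.UnboundedDenominatorsEisensteinWitnessRow
import Literature.NumberTheory.Automorphic.UnboundedDenominatorsHolonomyInputProofs
import HarnessLib

/-!
# The unbounded denominators theorem (Calegari–Dimitrov–Tang) — (4.3.3): `[M_N : M_2] ≥ N³/24`, and Theorem 1.0.1 from three printed inputs

PROOF-ONLY sequel (no definition, no named fact; D-0026). Source: F. Calegari, V. Dimitrov,
Y. Tang, *The unbounded denominators conjecture*, J. Amer. Math. Soc. **38** (2025), §4.2,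
display (4.3.3): "The degree of `M_N` over `M_2` is equal to the degree of the modular curve `Y(N)`
over `Y(2)`, and this is given by the explicit formula
`[M_N : M_2] = ½[Γ(2) : Γ(N)] = … > N³/(12 ζ(2))`", and §6.3.

Only the LOWER bound enters the proof of Theorem 1.0.1 (through (4.3.4)), and that is what is
proved here, by Galois theory inside the field `Mer` of the tree:

* `card_le_mul_relfinrank` — Dedekind/Artin: if finitely many field automorphisms `g ∈ s` fix `K`
  pointwise and at most `m` of them agree on `E ⊇ K` (`E/K` finite), then `#s ≤ m · [E : K]`
  (distinct `K`-embeddings `E → L` are `L`-linearly independent, Mathlib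
  `linearIndependent_toLinearMap`);
* `mem_Gamma_or_neg_mem_Gamma_of_smul_eq` — **the pointwise stabiliser of `M_N` in `SL(2, ℤ)` is
  `± Γ(N)`** (`N = 2d ≥ 4`): an element fixing the dilate `λ(dτ) ∈ M_N`
  (`UnboundedDenominatorsDilationWitnessProofs`) has `N ∣ c` (`dvd_of_smul_modularLambda_dilate_eq`,
  deck rigidity of `λ`), and one fixing the integral Eisenstein series `G₁₂^{(1,0)}/Δ ∈ M_N`
  (`exists_levelField_witness_row`, LEAD edix-p1) has `(a, b) ≡ ±(1, 0)`; the determinant does the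
  rest;
* ★★ `relfinrank_levelField_two_le_ge` — **(4.3.3), lower bound: `[M_N : M_2] ≥ N³/24` for every even
  `N > 0`** (as `IntermediateField.relfinrank`; finite-dimensionality of `M_N/M_2` comes from
  Proposition 3.0.1, `linearIndepOn_bddDenGens_card_le`): the `[Γ(2) : Γ(N)] = [SL₂(ℤ):Γ(N)]/6`
  cosets give automorphisms of `Mer/M_2` agreeing on `M_N` at most in pairs, and
  `[SL₂(ℤ) : Γ(N)] ≥ N³/2` (`pow_three_le_two_mul_index_Gamma`);
* ★★★ `CalegariDimitrovTang2025_unboundedDenominators.of_printed_inputs''''` — **Theorem 1.0.1 from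
  THREE printed inputs**: `hker₂` (amalgam + congruence subgroup property for `SL₂(ℤ[1/p])`),
  `hcor` (CDT Corollary 4.5.3) and Shimura's Theorem 3.52.

## References

* [CalegariDimitrovTang2025] F. Calegari, V. Dimitrov, Y. Tang, The unbounded denominators
  conjecture, J. Amer. Math. Soc. 38 (2025), no. 3, 627–702; arXiv:2109.09040. §4.2 (4.3.3), §6.3.
-/

noncomputable section

namespace Literature.NumberTheory.Automorphic

open scoped MatrixGroups ModularForm
open UpperHalfPlane CongruenceSubgroup Matrix.SpecialLinearGroup ModularGroup
open Literature.NumberTheory.Automorphic.ModularLambda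

namespace UnboundedDenominators

/-! ### §1. Dedekind: automorphisms agreeing on `E` at most `m` at a time -/

/-- **Dedekind–Artin count.** Let `K ≤ E` be intermediate fields of `L/F` with `E` finite over `K`,
and let `s` be a finite set of ring automorphisms of `L` (elements of a group `G` acting on `L`)
fixing `K` pointwise, such that for each `g ∈ s` at most `m` elements of `s` agree with `g` on
`E`. Then `#s ≤ m · [E : K]`: the restrictions to `E` are `K`-algebra maps `E → L`, and distinct
such maps are linearly independent over `L` (Dedekind), so there are at most `[E : K]` of them.
[cite: CalegariDimitrovTang2025, §4.2 (4.3.3) ("the degree of `M_N` over `M_2` is equal to the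
degree of the modular curve `Y(N)` over `Y(2)`")] -/
theorem card_le_mul_relfinrank {F L : Type*} [Field F] [Field L] [Algebra F L]
    {G : Type*} [Group G] [MulSemiringAction G L]
    {K E : IntermediateField F L} (hKE : K ≤ E)
    [FiniteDimensional K (IntermediateField.extendScalars hKE)]
    (s : Finset G) (hK : ∀ g ∈ s, ∀ x ∈ K, g • x = x) (m : ℕ)
    (hfib : ∀ g ∈ s, ∀ t ⊆ s, (∀ g' ∈ t, ∀ x ∈ E, g' • x = g • x) → t.card ≤ m) :
    s.card ≤ m * IntermediateField.relfinrank K E := by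
  classical
  set E' := IntermediateField.extendScalars hKE with hE'
  haveI : DecidableEq (E' →ₐ[K] L) := Classical.decEq _
  haveI : Module.Free K E' := Module.Free.of_divisionRing K E'
  haveI : Module.Finite L (E' →ₗ[K] L) := Module.Finite.linearMap K L E' L
  -- the `K`-algebra map `E' → L` attached to `g ∈ s`
  let σ : {g // g ∈ s} → (E' →ₐ[K] L) := fun g ↦
    { toFun := fun x ↦ (g : G) • (x : L)
      map_one' := by
        change (g : G) • ((1 : E') : L) = 1
        rw [OneMemClass.coe_one, smul_one]
      map_mul' := fun x y ↦ by
        change (g : G) • ((x * y : E') : L) = (g : G) • (x : L) * (g : G) • (y : L)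
        rw [MulMemClass.coe_mul, smul_mul']
      map_zero' := by
        change (g : G) • ((0 : E') : L) = 0
        rw [ZeroMemClass.coe_zero, smul_zero]
      map_add' := fun x y ↦ by
        change (g : G) • ((x + y : E') : L) = (g : G) • (x : L) + (g : G) • (y : L)
        rw [AddMemClass.coe_add, smul_add]
      commutes' := fun c ↦ hK g g.2 _ c.2 }
  have hσ : ∀ g g' : {g // g ∈ s}, σ g' = σ g → ∀ x ∈ E, (g' : G) • x = (g : G) • x := by
    intro g g' h x hx
    exact congrArg (fun φ : E' →ₐ[K] L ↦ φ ⟨x, hx⟩) h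
  -- fibres of `σ` have at most `m` elements
  have hcard : (Finset.univ : Finset {g // g ∈ s}).card ≤
      m * (Finset.univ.image σ).card := by
    refine Finset.card_le_mul_card_image _ m fun φ hφ ↦ ?_
    obtain ⟨g, -, rfl⟩ := Finset.mem_image.mp hφ
    calc (Finset.univ.filter fun g' : {g // g ∈ s} ↦ σ g' = σ g).card
        = ((Finset.univ.filter fun g' : {g // g ∈ s} ↦ σ g' = σ g).map
            (Function.Embedding.subtype (· ∈ s))).card := (Finset.card_map _).symm
      _ ≤ m := by
          refine hfib g g.2 _ (fun x hx ↦ ?_) (fun g' hg' ↦ ?_)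
          · obtain ⟨g'', -, rfl⟩ := Finset.mem_map.mp hx
            exact g''.2
          · obtain ⟨g'', hg'', rfl⟩ := Finset.mem_map.mp hg'
            exact hσ g g'' (Finset.mem_filter.mp hg'').2
  -- and there are at most `[E : K]` maps
  have hmaps : (Finset.univ.image σ).card ≤ IntermediateField.relfinrank K E := by
    calc (Finset.univ.image σ).card ≤ Fintype.card (E' →ₐ[K] L) := Finset.card_le_univ _
      _ ≤ Module.finrank L (E' →ₗ[K] L) :=
          (linearIndependent_toLinearMap K E' L).fintype_card_le_finrank
      _ = Module.finrank K E' := Module.finrank_linearMap_self K L E'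
      _ = IntermediateField.relfinrank K E := (IntermediateField.relfinrank_eq_finrank_of_le hKE).symm
  calc s.card = (Finset.univ : Finset {g // g ∈ s}).card := by simp
    _ ≤ m * (Finset.univ.image σ).card := hcard
    _ ≤ m * IntermediateField.relfinrank K E := Nat.mul_le_mul_left _ hmaps

/-! ### §2. The pointwise stabiliser of `M_N` is `± Γ(N)` -/

/-- `Γ(N') ≤ Γ(N)` for `N ∣ N'`. [folklore] -/
private theorem Gamma_le_Gamma_of_dvd' {N N' : ℕ} (h : N ∣ N') : Gamma N' ≤ Gamma N := by
  intro A hA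
  rw [Gamma_mem] at hA ⊢
  obtain ⟨h00, h01, h10, h11⟩ := hA
  have c00 := congrArg (ZMod.castHom h (ZMod N)) h00
  have c01 := congrArg (ZMod.castHom h (ZMod N)) h01
  have c10 := congrArg (ZMod.castHom h (ZMod N)) h10
  have c11 := congrArg (ZMod.castHom h (ZMod N)) h11
  rw [map_intCast, map_one] at c00 c11
  rw [map_intCast, map_zero] at c01 c10
  exact ⟨c00, c01, c10, c11⟩

/-- **Two elements of `M_N` whose common stabiliser in `SL(2, ℤ)` is `± Γ(N)`** (`N = 2d ≥ 4`):
the dilate `λ(dτ)` (`exists_modularLambda_dilate_mem_levelField`; its stabiliser lies in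
`Γ₀(N)` by `dvd_of_smul_modularLambda_dilate_eq`) and the normalised Eisenstein series
`G₁₂^{(1,0)}/Δ` (`exists_levelField_witness_row`; its stabiliser has `(a, b) ≡ ±(1, 0)`).
[cite: CalegariDimitrovTang2025, §4.2 (4.3.3)] -/
theorem exists_witnesses_stabilizer {d : ℕ} (hd : 2 ≤ d) :
    ∃ u₁ ∈ levelField (2 * d), ∃ u₂ ∈ levelField (2 * d), ∀ γ : SL(2, ℤ),
      γ • u₁ = u₁ → γ • u₂ = u₂ → γ ∈ Gamma (2 * d) ∨ -γ ∈ Gamma (2 * d) := by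
  have hd0 : 0 < d := by omega
  haveI : NeZero (2 * d) := ⟨by omega⟩
  -- the dilate `λ(dτ)`
  let A : GL (Fin 2) ℝ := Matrix.GeneralLinearGroup.mkOfDetNeZero !![(d : ℝ), 0; 0, 1]
    (by rw [Matrix.det_fin_two_of]; simp; positivity)
  have hA : (A : Matrix (Fin 2) (Fin 2) ℝ) = !![(d : ℝ), 0; 0, 1] := rfl
  obtain ⟨Λ, hΛ, hΛmem⟩ := exists_modularLambda_dilate_mem_levelField hA hd0
  -- the Eisenstein witness
  obtain ⟨u₂, hu₂, hrow⟩ := exists_levelField_witness_row (2 * d) (by omega)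
  refine ⟨algebraMap hol Mer Λ, hΛmem, u₂, hu₂, fun γ h₁ h₂ ↦ ?_⟩
  have hc : ((γ 1 0 : ℤ) : ZMod (2 * d)) = 0 := by
    rw [ZMod.intCast_zmod_eq_zero_iff_dvd]
    exact_mod_cast dvd_of_smul_modularLambda_dilate_eq hA hΛ h₁
  have hdet : ((γ 0 0 : ℤ) : ZMod (2 * d)) * ((γ 1 1 : ℤ) : ZMod (2 * d)) -
      ((γ 0 1 : ℤ) : ZMod (2 * d)) * ((γ 1 0 : ℤ) : ZMod (2 * d)) = 1 := by
    have h := Matrix.SpecialLinearGroup.det_coe γ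
    rw [Matrix.det_fin_two] at h
    have := congrArg (fun z : ℤ ↦ (z : ZMod (2 * d))) h
    push_cast at this
    exact this
  rcases hrow γ h₂ with ⟨ha, hb⟩ | ⟨ha, hb⟩
  · left
    rw [Gamma_mem]
    refine ⟨ha, hb, hc, ?_⟩
    rw [ha, hb, hc, one_mul, zero_mul, sub_zero] at hdet
    exact hdet
  · right
    have hd' : ((γ 1 1 : ℤ) : ZMod (2 * d)) = -1 := by
      rw [ha, hb, hc, zero_mul, sub_zero, neg_one_mul, neg_eq_iff_eq_neg] at hdet
      exact hdet
    rw [Gamma_mem]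
    simp only [Matrix.SpecialLinearGroup.coe_neg, Matrix.neg_apply, Int.cast_neg, ha, hb, hc, hd',
      neg_neg, neg_zero, and_self]

/-! ### §3. (4.3.3): `[M_N : M_2] ≥ N³/24` -/

/-- `-1 ∈ Γ(2)`. [folklore] -/
private theorem neg_one_mem_Gamma_two : (-1 : SL(2, ℤ)) ∈ Gamma 2 := by
  rw [Gamma_mem]
  simp only [Matrix.SpecialLinearGroup.coe_neg, Matrix.SpecialLinearGroup.coe_one,
    Matrix.neg_apply, Matrix.one_apply_eq, ne_eq, zero_ne_one, not_false_eq_true,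
    Matrix.one_apply_ne, one_ne_zero, neg_zero, Int.cast_zero, Int.cast_neg, Int.cast_one,
    and_self, true_and]
  decide

/-- **`M_N` is finite over `M_2`** for even `N > 0` — a by-product of Proposition 3.0.1
(`linearIndepOn_bddDenGens_card_le`: `[R_N : M_2] < ∞`, and `M_N ⊆ R_N`).
[cite: CalegariDimitrovTang2025, Lemma 4.2.2] -/
theorem finiteDimensional_levelField {N : ℕ} (hN : 0 < N) (heven : Even N)
    (hKE : levelField 2 ≤ levelField N) :
    FiniteDimensional (levelField 2) (IntermediateField.extendScalars hKE) := by
  obtain ⟨C, hC⟩ := linearIndepOn_bddDenGens_card_le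
  have hpos := (relfinrank_pos_and_le_of_linearIndepOn_real_bound hN heven (hC N hN heven)).1
  have hKR : levelField 2 ≤ bddDenField N := hKE.trans (levelField_le_bddDenField N)
  rw [IntermediateField.relfinrank_eq_finrank_of_le hKR] at hpos
  haveI : FiniteDimensional (levelField 2) (IntermediateField.extendScalars hKR) :=
    FiniteDimensional.of_finrank_pos hpos
  have hle : IntermediateField.extendScalars hKE ≤ IntermediateField.extendScalars hKR :=
    (IntermediateField.extendScalars_le_extendScalars_iff _ _).mpr (levelField_le_bddDenField N)
  exact FiniteDimensional.of_injective (IntermediateField.inclusion hle).toLinearMap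
    (IntermediateField.inclusion_injective hle)

/-- ★★ **CDT (4.3.3), lower bound: `[M_N : M_2] ≥ N³/24` for every even `N > 0`.**
[cite: CalegariDimitrovTang2025, §4.2 (4.3.3)] For `N = 2`: `[M_2 : M_2] = 1`. For
`N = 2d ≥ 4`: `M_N/M_2` is finite (Prop. 3.0.1); the `[Γ(2) : Γ(N)]` cosets of `Γ(N)` in `Γ(2)` act on
`Mer` fixing `M_2` pointwise, and two cosets act identically on `M_N` only if they agree up to
`±1` (`exists_witnesses_stabilizer`), so Dedekind's count (`card_le_mul_relfinrank`, `m = 2`)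
gives `[Γ(2) : Γ(N)] ≤ 2 [M_N : M_2]`; finally `[Γ(2) : Γ(N)] = [SL₂(ℤ):Γ(N)]/6 ≥ N³/12`
(`pow_three_le_two_mul_index_Gamma`, `index_Gamma_two`). -/
theorem relfinrank_levelField_ge : ∃ c : ℝ, 0 < c ∧ ∀ N : ℕ, 0 < N → Even N →
    c * (N : ℝ) ^ 3 ≤ IntermediateField.relfinrank (levelField 2) (levelField N) := by
  classical
  refine ⟨1 / 24, by norm_num, fun N hN heven ↦ ?_⟩
  obtain ⟨d, hd⟩ := heven
  have hNd : N = 2 * d := by omega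
  rcases Nat.lt_or_ge d 2 with hd2 | hd2
  · -- `N = 2`
    have hd1 : d = 1 := by omega
    subst hNd; subst hd1
    norm_num [IntermediateField.relfinrank_self]
  -- `N = 2d ≥ 4`
  subst hNd
  set N := 2 * d with hNdef
  haveI : NeZero N := ⟨by omega⟩
  have hKE : levelField 2 ≤ levelField N := levelField_mono two_pos ⟨d, rfl⟩ (by omega)
  haveI := finiteDimensional_levelField hN ⟨d, by omega⟩ hKE
  -- coset representatives of `Γ(N)` in `Γ(2)`
  have hNle : Gamma N ≤ Gamma 2 := Gamma_le_Gamma_of_dvd' ⟨d, rfl⟩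
  set Q := (Gamma 2) ⧸ (Gamma N).subgroupOf (Gamma 2) with hQ
  haveI : Fintype Q := Fintype.ofFinite Q
  let out : Q → SL(2, ℤ) := fun q ↦ ((Quotient.out q : Gamma 2) : SL(2, ℤ))
  have hout_inj : Function.Injective out := by
    intro q q' h
    have : (Quotient.out q : Gamma 2) = Quotient.out q' := Subtype.ext h
    rw [← Quotient.out_eq q, ← Quotient.out_eq q', this]
  set s : Finset SL(2, ℤ) := Finset.univ.image out with hs
  have hs_card : s.card = Fintype.card Q := by
    rw [hs, Finset.card_image_of_injective _ hout_inj, Finset.card_univ]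
  -- every `g ∈ s ⊆ Γ(2)` fixes `M_2`
  have hK : ∀ g ∈ s, ∀ x ∈ levelField 2, g • x = x := by
    intro g hg x hx
    obtain ⟨q, -, rfl⟩ := Finset.mem_image.mp hg
    exact mem_invariantField_iff.mp (levelField_le_invariantField 2 hx) _ (Quotient.out q).2
  -- fibres: at most two representatives agree on `M_N`
  obtain ⟨u₁, hu₁, u₂, hu₂, hstab⟩ := exists_witnesses_stabilizer hd2
  have hfib : ∀ g ∈ s, ∀ t ⊆ s, (∀ g' ∈ t, ∀ x ∈ levelField N, g' • x = g • x) →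
      t.card ≤ 2 := by
    intro g hg t hts ht
    obtain ⟨q, -, rfl⟩ := Finset.mem_image.mp hg
    set g₀ : Gamma 2 := Quotient.out q with hg₀
    have hneg : -(g₀ : SL(2, ℤ)) ∈ Gamma 2 := by
      simpa using (Gamma 2).mul_mem neg_one_mem_Gamma_two g₀.2
    let q' : Q := QuotientGroup.mk (⟨-(g₀ : SL(2, ℤ)), hneg⟩ : Gamma 2)
    refine (Finset.card_le_card (t := {out q, out q'}) ?_).trans (Finset.card_le_two)
    intro g' hg'
    have hagree := ht g' hg'
    obtain ⟨r, -, rfl⟩ := Finset.mem_image.mp (hts hg')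
    -- `γ := g₀⁻¹ · out r` acts trivially on `M_N`, hence lies in `± Γ(N)`
    have htriv : ∀ x ∈ levelField N, ((g₀ : SL(2, ℤ))⁻¹ * out r) • x = x := by
      intro x hx
      rw [mul_smul, hagree x hx, inv_smul_smul]
    rcases hstab _ (htriv u₁ hu₁) (htriv u₂ hu₂) with hmem | hmem
    · -- same coset
      have : q = r := by
        have e : (QuotientGroup.mk (Quotient.out q) : Q) = QuotientGroup.mk (Quotient.out r) := by
          refine QuotientGroup.eq.mpr ?_
          rw [Subgroup.mem_subgroupOf]
          simpa using hmem
        rwa [QuotientGroup.out_eq', QuotientGroup.out_eq'] at e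
      simp [this]
    · -- the coset of `-g₀`
      have : q' = r := by
        have e : (q' : Q) = QuotientGroup.mk (Quotient.out r) := by
          refine QuotientGroup.eq.mpr ?_
          rw [Subgroup.mem_subgroupOf]
          have e : ((((⟨-(g₀ : SL(2, ℤ)), hneg⟩ : Gamma 2)⁻¹ * Quotient.out r : Gamma 2)) :
              SL(2, ℤ)) = -(((g₀ : SL(2, ℤ)))⁻¹ * out r) := by
            simp [out, inv_neg, neg_mul]
          rw [e]
          exact hmem
        rwa [QuotientGroup.out_eq'] at e
      simp [this]
  -- Dedekind count
  have hcount := card_le_mul_relfinrank hKE s hK 2 hfib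
  -- index bookkeeping: `#s = [Γ(2) : Γ(N)] = [SL₂(ℤ) : Γ(N)] / 6 ≥ N³/12`
  have hindex : Fintype.card Q * 6 = (Gamma N).index := by
    rw [← Subgroup.relIndex_mul_index hNle, index_Gamma_two]
    congr 1
    rw [Subgroup.relIndex, Subgroup.index_eq_card, Nat.card_eq_fintype_card]
  have hN3 := pow_three_le_two_mul_index_Gamma N
  -- assemble in `ℝ`
  have h1 : (Fintype.card Q : ℝ) ≤ 2 * (IntermediateField.relfinrank (levelField 2) (levelField N) : ℝ) := by
    rw [← hs_card]; exact_mod_cast hcount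
  have h2 : ((N : ℝ)) ^ 3 ≤ 2 * ((Fintype.card Q : ℝ) * 6) := by
    have : ((N ^ 3 : ℕ) : ℝ) ≤ ((2 * (Gamma N).index : ℕ) : ℝ) := by exact_mod_cast hN3
    rw [← hindex] at this
    push_cast at this
    linarith
  linarith

/-! ### §4. Theorem 1.0.1 from three printed inputs -/

/-- ★★★ **CDT Theorem 1.0.1 from THREE printed inputs** [cite: CalegariDimitrovTang2025, §6.3]:
the named fact `CalegariDimitrovTang2025_unboundedDenominators` follows from `hker₂` (amalgam +
congruence subgroup property for `SL₂(ℤ[1/p])`, Serre/Mennicke), `hcor` (CDT Corollary 4.5.3) and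
Shimura's Theorem 3.52 (integral spanning of `M_{12m}(Γ(N))`). The degree bound (4.3.3)
(`relfinrank_levelField_ge`) and Proposition 3.0.1 (`linearIndepOn_bddDenGens_card_le`) are now
theorems of the tree. -/
theorem _root_.Literature.NumberTheory.Automorphic.CalegariDimitrovTang2025_unboundedDenominators.of_printed_inputs''''
    (hker₂ : ∀ (N p : ℕ) (A : GL (Fin 2) ℝ), 0 < N →
      (A : Matrix (Fin 2) (Fin 2) ℝ) = !![(p : ℝ), 0; 0, 1] → p.Prime → ¬ p ∣ N →
      ∀ (Δ : Type) [Group Δ] [Finite Δ] (g₁ g₂ : Gamma N →* Δ),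
      (∀ (x : SL(2, ℤ)) (hx : x ∈ Gamma N), x ∈ Gamma0 p → ∀ (y : SL(2, ℤ)) (hy : y ∈ Gamma N),
        A * mapGL ℝ x = mapGL ℝ y * A → g₁ ⟨x, hx⟩ = g₂ ⟨y, hy⟩) →
      (∃ M : ℕ, M ≠ 0 ∧ ∀ (x : SL(2, ℤ)) (hx : x ∈ Gamma N), x ∈ Gamma M → g₁ ⟨x, hx⟩ = 1) ∧
      (∃ M : ℕ, M ≠ 0 ∧ ∀ (x : SL(2, ℤ)) (hx : x ∈ Gamma N), x ∈ Gamma M → g₂ ⟨x, hx⟩ = 1))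
    (hcor : ∀ (N : ℕ) (Q : Type) [CommGroup Q] [Finite Q] (θ : Gamma N →* Q),
      (∀ g : SL(2, ℤ), ∃ M : ℕ, M ≠ 0 ∧ ∀ (x : SL(2, ℤ)) (hx : x ∈ Gamma N)
        (hgx : g * x * g⁻¹ ∈ Gamma N), x ∈ Gamma M → θ ⟨g * x * g⁻¹, hgx⟩ = θ ⟨x, hx⟩) →
      ∃ M : ℕ, M ≠ 0 ∧ ∀ (x : SL(2, ℤ)) (hx : x ∈ Gamma N), x ∈ Gamma M → θ ⟨x, hx⟩ = 1)
    (hShimura : ∀ (N : ℕ), 0 < N → ∀ (m : ℕ)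
      (F : ModularForm ((Gamma N : Subgroup SL(2, ℤ)) : Subgroup (GL (Fin 2) ℝ)) (12 * (m : ℤ))),
      ∃ (ι : Type) (_ : Fintype ι) (c : ι → ℂ)
      (B : ι → ModularForm ((Gamma N : Subgroup SL(2, ℤ)) : Subgroup (GL (Fin 2) ℝ)) (12 * (m : ℤ))),
      (∀ i (n : ℕ), ∃ z : ℤ, PowerSeries.coeff n (qExpansion (N : ℝ) (B i)) = (z : ℂ)) ∧
      (F : ℍ → ℂ) = ∑ i, c i • (B i : ℍ → ℂ)) :
    CalegariDimitrovTang2025_unboundedDenominators :=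
  CalegariDimitrovTang2025_unboundedDenominators.of_printed_inputs''' hker₂ hcor hShimura
    relfinrank_levelField_ge

/-! ### §5. The sharp count `[Γ(2) : Γ(N)] ≤ 2 [M_N : M_2]` -/

/-- ★ **Sharp form of the lower bound: `[Γ(2) : Γ(N)] ≤ 2 · [M_N : M_2]`** for `N = 2d ≥ 4`, i.e.
`[M_N : M_2] ≥ [Γ(2) : ±Γ(N)]` — one half of CDT's equality `[M_N : M_2] = ½[Γ(2) : Γ(N)]`
(the other half is Artin's lemma on the full level-`N` function field, see
`UnboundedDenominatorsRationalityProofs`). Same proof as `relfinrank_levelField_ge`, without the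
final numerical weakening. [cite: CalegariDimitrovTang2025, §4.2 (4.3.3)] -/
theorem card_quotient_le_two_mul_relfinrank {d : ℕ} (hd2 : 2 ≤ d) :
    Nat.card (Gamma 2 ⧸ (Gamma (2 * d)).subgroupOf (Gamma 2)) ≤
      2 * IntermediateField.relfinrank (levelField 2) (levelField (2 * d)) := by
  classical
  set N := 2 * d with hNdef
  have hN : 0 < N := by omega
  haveI : NeZero N := ⟨by omega⟩
  have hKE : levelField 2 ≤ levelField N := levelField_mono two_pos ⟨d, rfl⟩ (by omega)
  haveI := finiteDimensional_levelField hN ⟨d, by omega⟩ hKE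
  have hNle : Gamma N ≤ Gamma 2 := Gamma_le_Gamma_of_dvd' ⟨d, rfl⟩
  set Q := (Gamma 2) ⧸ (Gamma N).subgroupOf (Gamma 2) with hQ
  haveI : Fintype Q := Fintype.ofFinite Q
  let out : Q → SL(2, ℤ) := fun q ↦ ((Quotient.out q : Gamma 2) : SL(2, ℤ))
  have hout_inj : Function.Injective out := by
    intro q q' h
    have : (Quotient.out q : Gamma 2) = Quotient.out q' := Subtype.ext h
    rw [← Quotient.out_eq q, ← Quotient.out_eq q', this]
  set s : Finset SL(2, ℤ) := Finset.univ.image out with hs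
  have hs_card : s.card = Fintype.card Q := by
    rw [hs, Finset.card_image_of_injective _ hout_inj, Finset.card_univ]
  have hK : ∀ g ∈ s, ∀ x ∈ levelField 2, g • x = x := by
    intro g hg x hx
    obtain ⟨q, -, rfl⟩ := Finset.mem_image.mp hg
    exact mem_invariantField_iff.mp (levelField_le_invariantField 2 hx) _ (Quotient.out q).2
  obtain ⟨u₁, hu₁, u₂, hu₂, hstab⟩ := exists_witnesses_stabilizer hd2
  have hfib : ∀ g ∈ s, ∀ t ⊆ s, (∀ g' ∈ t, ∀ x ∈ levelField N, g' • x = g • x) →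
      t.card ≤ 2 := by
    intro g hg t hts ht
    obtain ⟨q, -, rfl⟩ := Finset.mem_image.mp hg
    set g₀ : Gamma 2 := Quotient.out q with hg₀
    have hneg : -(g₀ : SL(2, ℤ)) ∈ Gamma 2 := by
      simpa using (Gamma 2).mul_mem neg_one_mem_Gamma_two g₀.2
    let q' : Q := QuotientGroup.mk (⟨-(g₀ : SL(2, ℤ)), hneg⟩ : Gamma 2)
    refine (Finset.card_le_card (t := {out q, out q'}) ?_).trans (Finset.card_le_two)
    intro g' hg'
    have hagree := ht g' hg'
    obtain ⟨r, -, rfl⟩ := Finset.mem_image.mp (hts hg')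
    have htriv : ∀ x ∈ levelField N, ((g₀ : SL(2, ℤ))⁻¹ * out r) • x = x := by
      intro x hx
      rw [mul_smul, hagree x hx, inv_smul_smul]
    rcases hstab _ (htriv u₁ hu₁) (htriv u₂ hu₂) with hmem | hmem
    · have : q = r := by
        have e : (QuotientGroup.mk (Quotient.out q) : Q) = QuotientGroup.mk (Quotient.out r) := by
          refine QuotientGroup.eq.mpr ?_
          rw [Subgroup.mem_subgroupOf]
          simpa using hmem
        rwa [QuotientGroup.out_eq', QuotientGroup.out_eq'] at e
      simp [this]
    · have : q' = r := by
        have e : (q' : Q) = QuotientGroup.mk (Quotient.out r) := by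
          refine QuotientGroup.eq.mpr ?_
          rw [Subgroup.mem_subgroupOf]
          have e : ((((⟨-(g₀ : SL(2, ℤ)), hneg⟩ : Gamma 2)⁻¹ * Quotient.out r : Gamma 2)) :
              SL(2, ℤ)) = -(((g₀ : SL(2, ℤ)))⁻¹ * out r) := by
            simp [out, inv_neg, neg_mul]
          rw [e]
          exact hmem
        rwa [QuotientGroup.out_eq'] at e
      simp [this]
  have hcount := card_le_mul_relfinrank hKE s hK 2 hfib
  rw [Nat.card_eq_fintype_card, ← hs_card]
  exact hcount

end UnboundedDenominators

end Literature.NumberTheory.Automorphic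

end
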